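import Summits.CriticalPhenomena.Ising3D.Control2DL19BoxVTable
import Mathlib.Tactic.NormNum
import HarnessLib

/-!
# RB-2 certificate `j135119_functional_deriv2d_L19_E048_sig1o8_box0.975-0.98.json` (Λ = 19, E₀ = 48): Δ_ε ∉ [39/40, 49/50] at Δ_σ = 1/8 under A2D′ — (R), the large-`S` half, leaf chunks A (12 leaves)
(cell `pub-ising3x`, seat controls-1 gen 19; KERNEL PATH for the 2D γ-certificates, Λ = 19 — CONTROL-ONLY)

HONEST FRAMING: lottery ticket; floor = tightest certified 3D Ising CFT bounds; no exact-solution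
claim without a proof. CONTROL-ONLY (`d = 2`, `Δ_σ = 1/8`, the 2D Ising control; axiom set `A2D′`).

(R) for the table `wtboxV` (`Control2DL19BoxVTable`), kernel data only: the compactified region polynomial `QhatboxV`
(`S₁ = 96`, `d = 19`) is non-negative on `τ ∈ [0,1]`, `v ∈ [0,1]` by the tensor-Bernstein SHAPE tree `cregboxV`
(55 leaves; every Bernstein coefficient computed and decided in the kernel, `Control2DPolyCertAuto2`, in 14 chunks of
≤ 12 leaves re-assembled along the splits), and `S ≤ S₁` by the per-`J` shapes `cregJboxV` of the Table file;
the root fact `cregboxV_n0` and the per-`J` fact `cregJboxV_ok` are turned into hypothesis `hR` by `region_of_kernelCertAuto` INSIDE the assembly file `Control2DL19BoxV` (no standalone `region_boxV` theorem: its statement would coincide, up to the table's name, with the other Λ = 19 boxes' — gate dedup lint, controls-1 g17). No facts, standard axioms only.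

SPLIT (controls-1 g19): the gate caps one file at 600 s of elaboration and the whole 86-leaf tree took 613 s, so the kernel-decided
leaf CHUNKS live in `Control2DL19BoxVRegionA…` files (≤ 18 leaves each) and `Control2DL19BoxVRegion` re-assembles the nodes. This file: chunks cregboxV_n1, cregboxV_n3, cregboxV_n6, cregboxV_n8.
-/

namespace Summit.CriticalPhenomena.Ising3D.Control2D

open Literature.MathematicalPhysics.QuantumFieldTheory.ConformalBootstrap3D

set_option maxHeartbeats 0 in
set_option maxRecDepth 200000 in
/-- Chunk 1 of the large-`S` tree (box `q₁=2, a₁=0; q₂=1, a₂=0`; 5 leaves), decided in the kernel. [folklore] -/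
theorem cregboxV_n1 :
    checkAuto₂ QhatboxV 20 2 0 1 1 0 1
    (Shape₂.splitI (Shape₂.leaf) (Shape₂.splitO (Shape₂.splitI (Shape₂.leaf) (Shape₂.leaf)) (Shape₂.splitI (Shape₂.leaf) (Shape₂.leaf)))) = true := by
  decide +kernel

set_option maxHeartbeats 0 in
set_option maxRecDepth 200000 in
/-- Chunk 3 of the large-`S` tree (box `q₁=2, a₁=1; q₂=2, a₂=0`; 1 leaves), decided in the kernel. [folklore] -/
theorem cregboxV_n3 :
    checkAuto₂ QhatboxV 20 2 1 1 2 0 1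
    (Shape₂.leaf) = true := by
  decide +kernel

set_option maxHeartbeats 0 in
set_option maxRecDepth 200000 in
/-- Chunk 6 of the large-`S` tree (box `q₁=4, a₁=2; q₂=4, a₂=2`; 2 leaves), decided in the kernel. [folklore] -/
theorem cregboxV_n6 :
    checkAuto₂ QhatboxV 20 4 2 1 4 2 1
    (Shape₂.splitO (Shape₂.leaf) (Shape₂.leaf)) = true := by
  decide +kernel

set_option maxHeartbeats 0 in
set_option maxRecDepth 200000 in
/-- Chunk 8 of the large-`S` tree (box `q₁=8, a₁=4; q₂=4, a₂=3`; 4 leaves), decided in the kernel. [folklore] -/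
theorem cregboxV_n8 :
    checkAuto₂ QhatboxV 20 8 4 1 4 3 1
    (Shape₂.splitI (Shape₂.splitO (Shape₂.leaf) (Shape₂.splitI (Shape₂.leaf) (Shape₂.leaf))) (Shape₂.leaf)) = true := by
  decide +kernel

end Summit.CriticalPhenomena.Ising3D.Control2D
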